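import Summits.CriticalPhenomena.PercolationContinuityZ3.Theorems.PercFiniteBoxLRORenormaliseFromLinearLROBlockDefs
import Summits.CriticalPhenomena.PercolationContinuityZ3.Theorems.PercFiniteBoxLRORenormaliseFromLinearLROStubCoarseGlue

/-!
# `stub_denseGlue` of line `registered` (crux `PercFiniteBoxLRO.RenormaliseFromLinearLRO`,
# stmt-CriticalPhenomena-0857, reshape 2): an infinite coarse cluster of DENSE blocks carries an
# infinite open cluster meeting `Λ(K n)`

Registered stub `stub_denseGlue` of the lead's skeleton (reshape 2): the deterministic pull-back of the
planar coarse-graining `blockCfg n (denseBox K s m)` (objects file `…BlockDefs.lean`), `n = (2s+1)m`,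
`m ≥ 1`.  If the cluster of `0` in the coarse configuration of dense blocks is infinite, some vertex of
`Λ(K n) = box 3 (K n)` has an infinite open cluster in `ω`.

Proof.
* Transport (`dense_armEvent_shift_iff`, `dense_reachable_of_mem_openConnIn`): the block event at `a`
  is the dense block for the configuration shifted by `c = blockCentre n a`; the shifted configuration
  has the one-arm event at `y` iff `ω` has it at `y + c`, and its in-box connections are open paths of
  `ω` translated by `c`.
* The half-grids of neighbouring blocks coincide (`halfGrid_add_single_mem`, `halfGrid_sub_single_mem`):
  for `c' = c + n eᵢ` the translate by `c` of the half-grid `(i, true)` equals the translate by `c'` of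
  the half-grid `(i, false)`, because `(2s+1) ∣ n`.
* Pigeonhole gluing (`dense_reachable_of_adj`): hence the locally-large sets of the two blocks on that
  common half-grid correspond under `y' ↦ y' + n eᵢ` (same cardinality `L`), the two joined sets are
  subsets of one `L`-set with `2·#M > L` and `2·#M' > L`, so they meet (`Finset.card_union_add_card_inter`):
  a common point is joined in `ω` to both base points.
* Induction along coarse open paths (`dense_reachable_of_coarse`) and finite-to-one-ness of
  `b ↦ base point ∈ blockCentre n b + Λ(K n)` (`stub_denseGlue`, copied from `stub_coarseGlue`, p150840;
  a base point of a dense block has a joined point, hence lies in `Λ(K n)`, `mem_of_joinedCount_pos`).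

References: G. Grimmett, *Percolation*, 2nd ed. (1999), §7.4 pp.177–181 (static renormalisation,
Fig. 7.13); H. Duminil-Copin, V. Sidoravicius, V. Tassion, CPAM 69 (2016) §2.2.  The dense block and its
pigeonhole gluing are this line's device.  Pure theorem file.
-/

noncomputable section

namespace Summit.CriticalPhenomena.PercolationContinuityZ3.Theorems.RenormaliseFromLinearLRO

open Literature.Probability.Percolation Literature.Probability.LatticeModels
open MeasureTheory

/-! ## Transport through the shift of configurations -/

/-- The configuration shifted by `-c` has the one-arm event at `y` iff `ω` has it at `y + c`
(both are unions of in-box connection events, transported by `pathIn_shift_of_mem_openConnIn` /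
`mem_openConnIn_shift_of_pathIn`). -/
theorem dense_armEvent_shift_iff (c : Site 3) (ω : BondConfig (Site 3)) (y : Site 3) (s : ℕ) :
    BondConfig.relabel (sym2Equiv (Site.shift (-c))) ω ∈ DCT16.armEvent y s ↔
      ω ∈ DCT16.armEvent (y + c) s := by
  have hset : {z : Site 3 | z - c ∈ {w : Site 3 | w - y ∈ box 3 s}} =
      {z : Site 3 | z - (y + c) ∈ box 3 s} := by
    ext z
    have h : z - c - y = z - (y + c) := by abel
    simp only [Set.mem_setOf_eq, h]
  constructor
  · rintro ⟨a, ha, hconn⟩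
    refine ⟨a + c, by rwa [add_sub_add_right_eq_sub], ?_⟩
    have P := pathIn_shift_of_mem_openConnIn hconn
    rw [hset] at P
    exact DCT16.mem_openConnIn_of_pathIn P
  · rintro ⟨a, ha, hconn⟩
    have h : a - c - y = a - (y + c) := by abel
    refine ⟨a - c, by rwa [h], ?_⟩
    have P := DCT16.pathIn_of_mem_openConnIn hconn
    rw [← hset] at P
    have h' := mem_openConnIn_shift_of_pathIn P
    rwa [add_sub_cancel_right] at h'

/-- An in-`S` connection `x ⟷ y` of the configuration shifted by `-c` joins `x + c` to `y + c` in `ω`. -/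
theorem dense_reachable_of_mem_openConnIn {c : Site 3} {ω : BondConfig (Site 3)} {S : Set (Site 3)}
    {x y : Site 3} (h : BondConfig.relabel (sym2Equiv (Site.shift (-c))) ω ∈ openConnIn S x y) :
    (openGraph ω).Reachable (x + c) (y + c) :=
  DCT16.reachable_of_pathIn (pathIn_shift_of_mem_openConnIn h)

/-! ## The half-grids of neighbouring blocks coincide -/

/-- Grid points add. -/
theorem gridPt_add (s : ℕ) (z w : Site 3) : gridPt s (z + w) = gridPt s z + gridPt s w := by
  funext k
  simp only [gridPt_apply, Pi.add_apply, mul_add]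

/-- The grid point of `m eⱼ` is `n eⱼ`, `n = (2s+1)m`. -/
theorem gridPt_single (s m : ℕ) (j : Fin 3) :
    gridPt s (Pi.single j (m : ℤ)) = Pi.single j ((((2 * s + 1) * m : ℕ)) : ℤ) := by
  funext k
  simp only [gridPt_apply, Pi.single_apply]
  split_ifs
  · push_cast; ring
  · simp

/-- The half-grid `(i, false)` shifted by `n eᵢ`, `n = (2s+1)m`, lies in the half-grid `(i, true)`. -/
theorem halfGrid_add_single_mem {s m : ℕ} {i : Fin 2} {y : Site 3} (hy : y ∈ halfGrid s m i false) :
    y + Pi.single (Fin.castSucc i) ((((2 * s + 1) * m : ℕ)) : ℤ) ∈ halfGrid s m i true := by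
  simp only [halfGrid, Finset.mem_filter, Bool.false_eq_true, if_false, if_true] at hy ⊢
  obtain ⟨hyc, hyi⟩ := hy
  obtain ⟨z, hz, rfl⟩ := mem_coreGrid.1 hyc
  rw [mem_box] at hz
  have hs : (0 : ℤ) < ((2 * s + 1 : ℕ) : ℤ) := by positivity
  have hzi : z (Fin.castSucc i) ≤ 0 := by
    simp only [gridPt_apply] at hyi
    nlinarith [hyi]
  refine ⟨mem_coreGrid.2 ⟨z + Pi.single (Fin.castSucc i) (m : ℤ), ?_, ?_⟩, ?_⟩
  · rw [mem_box]
    intro k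
    have hk := hz k
    simp only [Pi.add_apply, Pi.single_apply]
    split_ifs with hki
    · subst hki; omega
    · omega
  · rw [gridPt_add, gridPt_single]
  · have hk := hz (Fin.castSucc i)
    simp only [Pi.add_apply, gridPt_apply, Pi.single_eq_same]
    push_cast
    nlinarith [hk.1]

/-- The half-grid `(i, true)` shifted by `-n eᵢ`, `n = (2s+1)m`, lies in the half-grid `(i, false)`. -/
theorem halfGrid_sub_single_mem {s m : ℕ} {i : Fin 2} {y : Site 3} (hy : y ∈ halfGrid s m i true) :
    y - Pi.single (Fin.castSucc i) ((((2 * s + 1) * m : ℕ)) : ℤ) ∈ halfGrid s m i false := by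
  simp only [halfGrid, Finset.mem_filter, Bool.false_eq_true, if_false, if_true] at hy ⊢
  obtain ⟨hyc, hyi⟩ := hy
  obtain ⟨z, hz, rfl⟩ := mem_coreGrid.1 hyc
  rw [mem_box] at hz
  have hs : (0 : ℤ) < ((2 * s + 1 : ℕ) : ℤ) := by positivity
  have hzi : 0 ≤ z (Fin.castSucc i) := by
    simp only [gridPt_apply] at hyi
    nlinarith [hyi]
  refine ⟨mem_coreGrid.2 ⟨z - Pi.single (Fin.castSucc i) (m : ℤ), ?_, ?_⟩, ?_⟩
  · rw [mem_box]
    intro k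
    have hk := hz k
    simp only [Pi.sub_apply, Pi.single_apply]
    split_ifs with hki
    · subst hki; omega
    · omega
  · rw [sub_eq_add_neg, gridPt_add, ← Pi.single_neg, sub_eq_add_neg, ← Pi.single_neg]
    congr 1
    funext k
    simp only [gridPt_apply, Pi.single_apply]
    split_ifs
    · push_cast; ring
    · simp
  · have hk := hz (Fin.castSucc i)
    simp only [Pi.sub_apply, gridPt_apply, Pi.single_eq_same]
    push_cast
    nlinarith [hk.2]

/-! ## Pigeonhole gluing of dense neighbours -/

/-- **Gluing of dense neighbouring blocks** `a`, `a + eᵢ` (centres `c`, `c' = c + n eᵢ`, `n = (2s+1)m`).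
If `x` is joined (for the configuration shifted by `-c`, inside `Λ(K n)`) to a strict majority of the
locally-large points of the half-grid `(i, true)` and `x'` (for the shift by `-c'`) to a strict majority
of those of the half-grid `(i, false)`, then `x + c` and `x' + c'` are joined in `ω`: the two half-grids
have the same global translate, on which the two local large sets are the same set (transport of the
one-arm events), so the two joined sets — two strict majorities of one finite set — share a point
(`Finset.card_union_add_card_inter`), which is joined in `ω` to both global base points. -/
theorem dense_reachable_of_adj {K s m : ℕ} {ω : BondConfig (Site 3)} (a : Site 2) (i : Fin 2)
    {x x' : Site 3}
    (hx : largeCount s (halfGrid s m i true)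
        (BondConfig.relabel (sym2Equiv (Site.shift (-blockCentre ((2 * s + 1) * m) a))) ω) <
      2 * joinedCount s ↑(box 3 (K * ((2 * s + 1) * m))) (halfGrid s m i true) x
        (BondConfig.relabel (sym2Equiv (Site.shift (-blockCentre ((2 * s + 1) * m) a))) ω))
    (hx' : largeCount s (halfGrid s m i false)
        (BondConfig.relabel (sym2Equiv
          (Site.shift (-blockCentre ((2 * s + 1) * m) (a + Pi.single i 1)))) ω) <
      2 * joinedCount s ↑(box 3 (K * ((2 * s + 1) * m))) (halfGrid s m i false) x'
        (BondConfig.relabel (sym2Equiv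
          (Site.shift (-blockCentre ((2 * s + 1) * m) (a + Pi.single i 1)))) ω)) :
    (openGraph ω).Reachable (x + blockCentre ((2 * s + 1) * m) a)
      (x' + blockCentre ((2 * s + 1) * m) (a + Pi.single i 1)) := by
  set n : ℕ := (2 * s + 1) * m with hn
  set c : Site 3 := blockCentre n a with hc
  set v : Site 3 := Pi.single (Fin.castSucc i) (n : ℤ) with hv
  have hc' : blockCentre n (a + Pi.single i 1) = c + v := blockCentre_add_single n a i
  rw [hc'] at hx' ⊢
  set ωa : BondConfig (Site 3) := BondConfig.relabel (sym2Equiv (Site.shift (-c))) ω with hωa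
  set ωa' : BondConfig (Site 3) := BondConfig.relabel (sym2Equiv (Site.shift (-(c + v)))) ω with hωa'
  set L : Finset (Site 3) := largeSet s (halfGrid s m i true) ωa with hL
  set L' : Finset (Site 3) := largeSet s (halfGrid s m i false) ωa' with hL'
  set M : Finset (Site 3) := joinedSet s ↑(box 3 (K * n)) (halfGrid s m i true) x ωa with hM
  set M' : Finset (Site 3) := joinedSet s ↑(box 3 (K * n)) (halfGrid s m i false) x' ωa' with hM'
  -- the two local large sets correspond under `y' ↦ y' + v`
  have hLL : L'.image (· + v) = L := by
    ext y
    simp only [Finset.mem_image, hL, hL', mem_largeSet, hωa, hωa', dense_armEvent_shift_iff]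
    constructor
    · rintro ⟨y', ⟨hy'G, hy'arm⟩, rfl⟩
      have h : y' + v + c = y' + (c + v) := by abel
      rw [h]
      exact ⟨halfGrid_add_single_mem hy'G, hy'arm⟩
    · rintro ⟨hyG, hyarm⟩
      refine ⟨y - v, ⟨halfGrid_sub_single_mem hyG, ?_⟩, sub_add_cancel y v⟩
      have h : y - v + (c + v) = y + c := by abel
      rwa [h]
  have hinj : Function.Injective (fun y : Site 3 => y + v) := add_left_injective v
  have hcardL : L'.card = L.card := by
    rw [← hLL, Finset.card_image_of_injective _ hinj]
  -- pigeonhole: two strict majorities of the `L.card` large points meet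
  have hML : M ⊆ L := joinedSet_subset_largeSet s _ _ x ωa
  have hM'L : M'.image (· + v) ⊆ L :=
    hLL ▸ Finset.image_subset_image (joinedSet_subset_largeSet s _ _ x' ωa')
  have hcardM' : (M'.image (· + v)).card = M'.card := Finset.card_image_of_injective _ hinj
  have hunion : (M ∪ M'.image (· + v)).card ≤ L.card :=
    Finset.card_le_card (Finset.union_subset hML hM'L)
  have hie := Finset.card_union_add_card_inter M (M'.image (· + v))
  have hx1 : L.card < 2 * M.card := hx
  have hx2 : L'.card < 2 * M'.card := hx'
  obtain ⟨t, ht⟩ : (M ∩ M'.image (· + v)).Nonempty := by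
    rw [← Finset.card_pos]
    omega
  rw [Finset.mem_inter, Finset.mem_image] at ht
  obtain ⟨htM, y', hy'M', rfl⟩ := ht
  -- the common large point is joined in `ω` to both global base points
  have r1 := dense_reachable_of_mem_openConnIn (mem_joinedSet.1 htM).2.2
  have r2 := dense_reachable_of_mem_openConnIn (mem_joinedSet.1 hy'M').2.2
  have h : y' + v + c = y' + (c + v) := by abel
  rw [h] at r1
  exact r1.trans r2.symm

/-! ## Along coarse open paths -/

/-- **Induction along coarse open paths.**  With one base point `X b` (local coordinates) chosen for
every dense block `b`, every block `b` of the coarse open cluster of `0` has `X b + blockCentre n b`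
joined to `X 0 + blockCentre n 0` in `ω`: each coarse-open edge is `{a, a + eᵢ}` with both blocks
dense (unfolding `blockCfg`), glued by `dense_reachable_of_adj`. -/
theorem dense_reachable_of_coarse {K s m : ℕ} {ω : BondConfig (Site 3)} (X : Site 2 → Site 3)
    (hX : ∀ b : Site 2, ω ∈ blockEvent ((2 * s + 1) * m) (denseBox K s m) b →
      ∀ (j : Fin 2) (bb : Bool), largeCount s (halfGrid s m j bb)
          (BondConfig.relabel (sym2Equiv (Site.shift (-blockCentre ((2 * s + 1) * m) b))) ω) <
        2 * joinedCount s ↑(box 3 (K * ((2 * s + 1) * m))) (halfGrid s m j bb) (X b)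
          (BondConfig.relabel (sym2Equiv (Site.shift (-blockCentre ((2 * s + 1) * m) b))) ω))
    {b : Site 2} (h : (openGraph (blockCfg ((2 * s + 1) * m) (denseBox K s m) ω)).Reachable 0 b) :
    (openGraph ω).Reachable (X 0 + blockCentre ((2 * s + 1) * m) 0)
      (X b + blockCentre ((2 * s + 1) * m) b) := by
  rw [SimpleGraph.reachable_iff_reflTransGen] at h
  induction h with
  | refl => exact SimpleGraph.Reachable.refl _
  | @tail b₁ b₂ _ hadj ih =>
    obtain ⟨hmem, -⟩ := (openGraph_adj _ b₁ b₂).1 hadj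
    simp only [blockCfg, Set.mem_setOf_eq] at hmem
    obtain ⟨a, i, he, hda, hda'⟩ := hmem
    have key := dense_reachable_of_adj (K := K) a i (hX a hda i true) (hX _ hda' i false)
    rw [Sym2.eq_iff] at he
    rcases he with ⟨rfl, rfl⟩ | ⟨rfl, rfl⟩
    · exact ih.trans key
    · exact ih.trans key.symm

/-! ## The registered stub -/

/-- **Registered stub `stub_denseGlue` of crux stmt-CriticalPhenomena-0857 (line `registered`,
reshape 2)**, with the grid-size hypothesis `1 ≤ m` (for `m = 0` all centres coincide and the
statement fails, e.g. `K = s = m = 0`, `ω = ∅`): if the cluster of `0` in the coarse configuration of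
dense blocks (spacing `n = (2s+1)m`) is infinite, some vertex of `Λ(K n)` has an infinite open cluster
in `ω` — the base points of neighbouring dense blocks are joined in `ω` (`dense_reachable_of_adj`,
pigeonhole), so the base points of the blocks of the coarse cluster of `0`, all joined to the base point
`X 0 ∈ Λ(K n)` of the block `0` and each inside its own block, form an unbounded set. -/
theorem stub_denseGlue :
    ∀ (K s m : ℕ), 1 ≤ m → ∀ (ω : BondConfig (Site 3)),
      blockCfg ((2 * s + 1) * m) (denseBox K s m) ω ∈ percolatesAt (0 : Site 2) →
        ∃ x ∈ box 3 (K * ((2 * s + 1) * m)), ω ∈ percolatesAt x := by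
  intro K s m hm ω hperc
  set n : ℕ := (2 * s + 1) * m with hn
  have hn1 : 1 ≤ n := Nat.mul_pos (Nat.succ_pos _) hm
  set N : ℕ := K * n with hN
  -- one base point per dense block (local coordinates), `0` for the other blocks
  have hXex : ∀ b : Site 2, ∃ x : Site 3, x ∈ box 3 N ∧
      (ω ∈ blockEvent n (denseBox K s m) b → ∀ (j : Fin 2) (bb : Bool),
        largeCount s (halfGrid s m j bb)
            (BondConfig.relabel (sym2Equiv (Site.shift (-blockCentre n b))) ω) <
          2 * joinedCount s ↑(box 3 N) (halfGrid s m j bb) x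
            (BondConfig.relabel (sym2Equiv (Site.shift (-blockCentre n b))) ω)) := by
    intro b
    by_cases hb : ω ∈ blockEvent n (denseBox K s m) b
    · have hb' : BondConfig.relabel (sym2Equiv (Site.shift (-blockCentre n b))) ω ∈ denseBox K s m := hb
      obtain ⟨x, hx⟩ := hb'
      have h0 := hx 0 true
      have hpos : 0 < joinedCount s ↑(box 3 N) (halfGrid s m 0 true) x
          (BondConfig.relabel (sym2Equiv (Site.shift (-blockCentre n b))) ω) := by
        have h0' : largeCount s (halfGrid s m 0 true)
            (BondConfig.relabel (sym2Equiv (Site.shift (-blockCentre n b))) ω) <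
          2 * joinedCount s ↑(box 3 N) (halfGrid s m 0 true) x
            (BondConfig.relabel (sym2Equiv (Site.shift (-blockCentre n b))) ω) := h0
        omega
      exact ⟨x, Finset.mem_coe.1 (mem_of_joinedCount_pos hpos), fun _ => hx⟩
    · exact ⟨0, by simp, fun h => absurd h hb⟩
  choose X hXbox hX using hXex
  refine ⟨X 0, hXbox 0, ?_⟩
  -- adapted from `stub_coarseGlue` / `exists_infinite_openCluster_of_coarse` (SlabCriticalityInputs.lean)
  have hinf : (openCluster (blockCfg n (denseBox K s m) ω) (0 : Site 2)).Infinite := hperc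
  by_contra hcon
  have hcon' : ¬ (openCluster ω (X 0)).Infinite := hcon
  have hfin : (openCluster ω (X 0)).Finite := Set.not_infinite.1 hcon'
  obtain ⟨M, hM⟩ : ∃ M : ℕ, ∀ v ∈ openCluster ω (X 0), |v 0| ≤ M ∧ |v 1| ≤ M := by
    obtain ⟨B, hB⟩ := (hfin.image fun v => max |v 0| |v 1|).bddAbove
    refine ⟨B.toNat, fun v hv => ?_⟩
    have h' : max |v 0| |v 1| ≤ (B.toNat : ℤ) :=
      (hB (Set.mem_image_of_mem _ hv)).trans (Int.self_le_toNat B)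
    exact ⟨(le_max_left _ _).trans h', (le_max_right _ _).trans h'⟩
  obtain ⟨y, hy, hyF⟩ := hinf.exists_notMem_finset (box 2 (M + N))
  have hreach := dense_reachable_of_coarse (K := K) X hX hy
  rw [blockCentre_zero, add_zero] at hreach
  obtain ⟨h0, h1⟩ := hM _ hreach
  have e0 : (X y + blockCentre n y) 0 = X y 0 + n * y 0 := by simp [blockCentre]
  have e1 : (X y + blockCentre n y) 1 = X y 1 + n * y 1 := by simp [blockCentre]
  rw [e0, abs_le] at h0
  rw [e1, abs_le] at h1
  have hXy := mem_box.1 (hXbox y)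
  obtain ⟨hx0, hx0'⟩ := hXy 0
  obtain ⟨hx1, hx1'⟩ := hXy 1
  have key : ∀ i, (y i).natAbs ≤ ((n : ℤ) * y i).natAbs := fun i => by
    rw [Int.natAbs_mul, Int.natAbs_natCast]; exact Nat.le_mul_of_pos_left _ hn1
  have k0 := key 0
  have k1 := key 1
  simp only [mem_box, not_forall, not_and_or, not_le] at hyF
  obtain ⟨j, hj⟩ := hyF
  fin_cases j <;> simp at hj <;> omega

end Summit.CriticalPhenomena.PercolationContinuityZ3.Theorems.RenormaliseFromLinearLRO

end
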